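import Mathlib
import HarnessLib

/-!
# `NoHeavyLowerTail` (stmt-CriticalPhenomena-4575) — class odds, balanced pair: `O_{X,d}·O_{X,d'} ≥ Φ_X²`

Support file (prover `prim-gen-swap` gen 11; `--supports stmt-CriticalPhenomena-4575`).  No definitions, no named facts, no sorries.

Lemma L1.2 of the seat memo U1-PROOF.md (word budget at class level for the r-avoiding MWF supply inequality U1′_r).  For a class `X`
(finite set of stars) with extreme coefficients `a_i(0), a_i(1), a_i(2)` (`StarSet.extreme_regroup`) the two "class odds"
`O_{X,1} = Π_i(a_i(0)+a_i(1))/Π_i a_i(0) − 1` and `O_{X,2}` satisfy `O_{X,1}·O_{X,2} ≥ (Σ_i φ(θ_i))²`, `φ(θ) = √θ/(1−√θ)`: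
expand the products to first order (`Π(1+u_i) − 1 ≥ Σ u_i`), apply Cauchy–Schwarz, and use the one-star AM–GM bound
`a(1)a(2)(1−√θ)² ≥ a(0)²θ` (`StarSet.extremeCoeff_one_mul_two`).  Stated in the multiplied-out form (no divisions by `Π a(0)`).

* `StarSet.one_add_sum_le_prod_one_add'` — `1 + Σ x_i ≤ Π(1 + x_i)` for `x_i ≥ 0`;
* `StarSet.prod_add_sub_prod_ge` — `Π(a0+a1) − Π a0 ≥ Π a0 · Σ a1/a0`;
* `StarSet.classOdds_mul_ge_sq_sum_phi` — `(Π a0)²·(Σ_i φ(θ_i))² ≤ (Π(a0+a1) − Π a0)·(Π(a0+a2) − Π a0)`;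
* `StarSet.two_mul_prod_le_prod_add_prod` — AM–GM across classes: `2Π c_X ≤ Π M₁_X + Π M₂_X` when `c_X² ≤ M₁_XM₂_X` (appended, gen 11).
-/

namespace Summit.CriticalPhenomena.PercolationContinuityZ3.Theorems

open Finset
open scoped BigOperators

namespace StarSet

/-- `1 + Σ_{i∈s} x_i ≤ Π_{i∈s}(1 + x_i)` for nonnegative reals. [folklore] -/
theorem one_add_sum_le_prod_one_add' {ι : Type*} (s : Finset ι) (x : ι → ℝ) :
    (∀ i ∈ s, 0 ≤ x i) → 1 + ∑ i ∈ s, x i ≤ ∏ i ∈ s, (1 + x i) := by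
  classical
  induction s using Finset.cons_induction with
  | empty => intro _; simp
  | cons a s ha ih =>
    intro hx
    rw [sum_cons, prod_cons]
    have hxa : 0 ≤ x a := hx a (mem_cons_self a s)
    have hs : 1 + ∑ i ∈ s, x i ≤ ∏ i ∈ s, (1 + x i) := ih fun i hi => hx i (mem_cons.2 (Or.inr hi))
    have hsum : 0 ≤ ∑ i ∈ s, x i := sum_nonneg fun i hi => hx i (mem_cons.2 (Or.inr hi))
    have hQ : 1 ≤ ∏ i ∈ s, (1 + x i) := by linarith
    nlinarith

/-- **First-order expansion of a class odds: `Π(a0+a1) − Π a0 ≥ Π a0 · Σ a1/a0`** (`a0 > 0`, `a1 ≥ 0`). [U1-PROOF.md L1.2] -/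
theorem prod_add_sub_prod_ge {ι : Type*} (X : Finset ι) (a0 a1 : ι → ℝ)
    (h0 : ∀ i ∈ X, 0 < a0 i) (h1 : ∀ i ∈ X, 0 ≤ a1 i) :
    (∏ i ∈ X, a0 i) * ∑ i ∈ X, a1 i / a0 i ≤ (∏ i ∈ X, (a0 i + a1 i)) - ∏ i ∈ X, a0 i := by
  have hfac : ∏ i ∈ X, (a0 i + a1 i) = (∏ i ∈ X, a0 i) * ∏ i ∈ X, (1 + a1 i / a0 i) := by
    rw [← prod_mul_distrib]
    refine prod_congr rfl fun i hi => ?_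
    have := ne_of_gt (h0 i hi)
    field_simp
  have hP0 : 0 ≤ ∏ i ∈ X, a0 i := prod_nonneg fun i hi => le_of_lt (h0 i hi)
  have hexp : 1 + ∑ i ∈ X, a1 i / a0 i ≤ ∏ i ∈ X, (1 + a1 i / a0 i) :=
    one_add_sum_le_prod_one_add' X (fun i => a1 i / a0 i) fun i hi => div_nonneg (h1 i hi) (le_of_lt (h0 i hi))
  rw [hfac]
  nlinarith [mul_le_mul_of_nonneg_left hexp hP0]

/-- **Balanced pair at class level: `(Π a0)²·(Σ_i φ(θ_i))² ≤ (Π(a0+a1) − Π a0)(Π(a0+a2) − Π a0)`**, given the one-star bound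
`a0²θ ≤ a1·a2·(1−√θ)²` for every star (this is `StarSet.extremeCoeff_one_mul_two`) and `θ < 1`. [U1-PROOF.md L1.2] -/
theorem classOdds_mul_ge_sq_sum_phi {ι : Type*} (X : Finset ι) (a0 a1 a2 θ : ι → ℝ)
    (h0 : ∀ i ∈ X, 0 < a0 i) (h1 : ∀ i ∈ X, 0 ≤ a1 i) (h2 : ∀ i ∈ X, 0 ≤ a2 i)
    (hθ0 : ∀ i ∈ X, 0 ≤ θ i) (hθ1 : ∀ i ∈ X, θ i < 1)
    (hgm : ∀ i ∈ X, a0 i ^ 2 * θ i ≤ a1 i * a2 i * (1 - Real.sqrt (θ i)) ^ 2) :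
    (∏ i ∈ X, a0 i) ^ 2 * (∑ i ∈ X, Real.sqrt (θ i) / (1 - Real.sqrt (θ i))) ^ 2 ≤
      ((∏ i ∈ X, (a0 i + a1 i)) - ∏ i ∈ X, a0 i) * ((∏ i ∈ X, (a0 i + a2 i)) - ∏ i ∈ X, a0 i) := by
  set P0 := ∏ i ∈ X, a0 i with hP0def
  have hP0 : 0 ≤ P0 := prod_nonneg fun i hi => le_of_lt (h0 i hi)
  set U := ∑ i ∈ X, a1 i / a0 i with hU
  set V := ∑ i ∈ X, a2 i / a0 i with hV
  have hU0 : 0 ≤ U := sum_nonneg fun i hi => div_nonneg (h1 i hi) (le_of_lt (h0 i hi))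
  have hV0 : 0 ≤ V := sum_nonneg fun i hi => div_nonneg (h2 i hi) (le_of_lt (h0 i hi))
  have hA : P0 * U ≤ (∏ i ∈ X, (a0 i + a1 i)) - P0 := prod_add_sub_prod_ge X a0 a1 h0 h1
  have hB : P0 * V ≤ (∏ i ∈ X, (a0 i + a2 i)) - P0 := prod_add_sub_prod_ge X a0 a2 h0 h2
  -- per star: `φ(θ_i) ≤ √(u_i v_i)` with `u = a1/a0`, `v = a2/a0`
  have hstar : ∀ i ∈ X, Real.sqrt (θ i) / (1 - Real.sqrt (θ i)) ≤ Real.sqrt (a1 i / a0 i) * Real.sqrt (a2 i / a0 i) := by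
    intro i hi
    have ha0 : 0 < a0 i := h0 i hi
    have hne : a0 i ≠ 0 := ne_of_gt ha0
    have hs1 : Real.sqrt (θ i) < 1 := by
      rw [show (1 : ℝ) = Real.sqrt 1 by simp]
      exact Real.sqrt_lt_sqrt (hθ0 i hi) (hθ1 i hi)
    have hden : 0 < 1 - Real.sqrt (θ i) := by linarith
    rw [← Real.sqrt_mul (div_nonneg (h1 i hi) (le_of_lt ha0))]
    have hrhs : Real.sqrt (a1 i / a0 i * (a2 i / a0 i)) = Real.sqrt (a1 i * a2 i) / a0 i := by
      rw [show a1 i / a0 i * (a2 i / a0 i) = (a1 i * a2 i) / (a0 i) ^ 2 by field_simp]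
      rw [Real.sqrt_div' _ (sq_nonneg _), Real.sqrt_sq (le_of_lt ha0)]
    rw [hrhs, div_le_div_iff₀ hden ha0]
    have hl : 0 ≤ Real.sqrt (θ i) * a0 i := mul_nonneg (Real.sqrt_nonneg _) (le_of_lt ha0)
    have hr : 0 ≤ Real.sqrt (a1 i * a2 i) * (1 - Real.sqrt (θ i)) := mul_nonneg (Real.sqrt_nonneg _) (le_of_lt hden)
    have hsq : (Real.sqrt (θ i) * a0 i) ^ 2 ≤ (Real.sqrt (a1 i * a2 i) * (1 - Real.sqrt (θ i))) ^ 2 := by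
      rw [mul_pow, mul_pow, Real.sq_sqrt (hθ0 i hi), Real.sq_sqrt (mul_nonneg (h1 i hi) (h2 i hi))]
      nlinarith [hgm i hi]
    exact (pow_le_pow_iff_left₀ hl hr two_ne_zero).1 hsq
  -- Cauchy–Schwarz: `(Σ √u √v)² ≤ (Σ u)(Σ v)`
  have hCS : (∑ i ∈ X, Real.sqrt (a1 i / a0 i) * Real.sqrt (a2 i / a0 i)) ^ 2 ≤ U * V := by
    have h := sum_mul_sq_le_sq_mul_sq X (fun i => Real.sqrt (a1 i / a0 i)) (fun i => Real.sqrt (a2 i / a0 i))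
    have hu : ∑ i ∈ X, Real.sqrt (a1 i / a0 i) ^ 2 = U :=
      sum_congr rfl fun i hi => Real.sq_sqrt (div_nonneg (h1 i hi) (le_of_lt (h0 i hi)))
    have hv : ∑ i ∈ X, Real.sqrt (a2 i / a0 i) ^ 2 = V :=
      sum_congr rfl fun i hi => Real.sq_sqrt (div_nonneg (h2 i hi) (le_of_lt (h0 i hi)))
    rw [hu, hv] at h
    exact h
  have hΦ0 : 0 ≤ ∑ i ∈ X, Real.sqrt (θ i) / (1 - Real.sqrt (θ i)) := by
    refine sum_nonneg fun i hi => div_nonneg (Real.sqrt_nonneg _) ?_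
    have hs1 : Real.sqrt (θ i) ≤ 1 := by
      rw [show (1 : ℝ) = Real.sqrt 1 by simp]; exact Real.sqrt_le_sqrt (le_of_lt (hθ1 i hi))
    linarith
  have hΦ : (∑ i ∈ X, Real.sqrt (θ i) / (1 - Real.sqrt (θ i))) ^ 2 ≤ U * V :=
    le_trans (pow_le_pow_left₀ hΦ0 (sum_le_sum hstar) 2) hCS
  calc (∏ i ∈ X, a0 i) ^ 2 * (∑ i ∈ X, Real.sqrt (θ i) / (1 - Real.sqrt (θ i))) ^ 2
      ≤ P0 ^ 2 * (U * V) := by rw [← hP0def]; exact mul_le_mul_of_nonneg_left hΦ (sq_nonneg _)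
    _ = (P0 * U) * (P0 * V) := by ring
    _ ≤ ((∏ i ∈ X, (a0 i + a1 i)) - P0) * ((∏ i ∈ X, (a0 i + a2 i)) - P0) :=
        mul_le_mul hA hB (mul_nonneg hP0 hV0) (le_trans (mul_nonneg hP0 hU0) hA)


/-- **Two designations of a class-word family (AM–GM across classes).**  If class by class the two pattern masses `M₁_X, M₂_X ≥ 0` satisfy
`c_X² ≤ M₁_X·M₂_X` with `c_X ≥ 0` (e.g. `c_X = (Π a0)·Φ_X` by `StarSet.classOdds_mul_ge_sq_sum_phi`), then the two words together weigh at least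
`2·Π_X c_X`:  `2·Π c ≤ Π M₁ + Π M₂`. [U1-PROOF.md L1.4, k = 2] -/
theorem two_mul_prod_le_prod_add_prod {κ : Type*} (T : Finset κ) (M₁ M₂ c : κ → ℝ)
    (h1 : ∀ X ∈ T, 0 ≤ M₁ X) (h2 : ∀ X ∈ T, 0 ≤ M₂ X) (hc : ∀ X ∈ T, 0 ≤ c X)
    (h : ∀ X ∈ T, c X ^ 2 ≤ M₁ X * M₂ X) :
    2 * ∏ X ∈ T, c X ≤ (∏ X ∈ T, M₁ X) + ∏ X ∈ T, M₂ X := by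
  have hsq : (∏ X ∈ T, c X) ^ 2 ≤ (∏ X ∈ T, M₁ X) * ∏ X ∈ T, M₂ X := by
    rw [← prod_pow, ← prod_mul_distrib]
    exact prod_le_prod (fun X hX => sq_nonneg (c X)) (fun X hX => h X hX)
  have hc0 : 0 ≤ ∏ X ∈ T, c X := prod_nonneg fun X hX => hc X hX
  have hA : 0 ≤ ∏ X ∈ T, M₁ X := prod_nonneg fun X hX => h1 X hX
  have hB : 0 ≤ ∏ X ∈ T, M₂ X := prod_nonneg fun X hX => h2 X hX
  nlinarith [sq_nonneg ((∏ X ∈ T, M₁ X) - ∏ X ∈ T, M₂ X), hsq, mul_nonneg hA hB]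

end StarSet

end Summit.CriticalPhenomena.PercolationContinuityZ3.Theorems
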